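import Mathlib

/-!
# Rigidity of local sections of a local homeomorphism with orbit fibres

Kernel annex of the blind cell `pub-hodge-repro2` (seat p2).  Abstract (Mathlib-only) input for
`BallQuotientComplexManifold.lean`: let `f : X → Y` be a local homeomorphism whose fibres are the
orbits of a group `G` acting continuously on `X` (the quotient map `𝔹² → Γ\𝔹²` of the transfer,
once `Γ` acts freely and properly discontinuously — `BallQuotientCovering.lean`).  If two
continuous families `u, v : P → X` have the same image under `f` near a parameter `p₀`, then near
`p₀` they differ by ONE fixed group element: `v p = g • u p`.  Applied to two local inverses of
`f`, this says the transition maps of the pushed-forward charts of `Y` are locally given by the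
action of a single `g ∈ G` — the standard "deck transformations are locally constant" step in
the proof that a quotient of a complex manifold by a free properly discontinuous holomorphic
action is a complex manifold.
-/

namespace Summit.Ventures.HodgeRepro2.DeckRigidity

open Topology Filter

variable {X Y P : Type*} [TopologicalSpace X] [TopologicalSpace Y] [TopologicalSpace P]
variable {G : Type*} [Group G] [MulAction G X] [ContinuousConstSMul G X]
variable {f : X → Y}

/-- **Local rigidity of sections.** Let `f : X → Y` be a local homeomorphism, constant on the
orbits of a continuous action of `G` on `X` (`hfG`) and with fibres contained in orbits
(`horb`).  If `u v : P → X` are continuous at `p₀` and `f ∘ u = f ∘ v` near `p₀`, then there is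
a single `g : G` with `v p = g • u p` for all `p` near `p₀`.

Proof: pick `g` with `g • u p₀ = v p₀`; on the target of the local inverse of `f` at `u p₀`
the map `f` is injective, and both `u p` and `g⁻¹ • v p` lie there for `p` near `p₀`. -/
theorem eventually_eq_smul_of_isLocalHomeomorph (hf : IsLocalHomeomorph f)
    (hfG : ∀ (g : G) (x : X), f (g • x) = f x)
    (horb : ∀ x x' : X, f x = f x' → ∃ g : G, g • x = x')
    {u v : P → X} {p₀ : P} (hu : ContinuousAt u p₀) (hv : ContinuousAt v p₀)
    (huv : ∀ᶠ p in 𝓝 p₀, f (u p) = f (v p)) :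
    ∃ g : G, ∀ᶠ p in 𝓝 p₀, v p = g • u p := by
  obtain ⟨g₀, hg₀⟩ := horb (u p₀) (v p₀) huv.self_of_nhds
  refine ⟨g₀, ?_⟩
  have hT : (hf.localInverseAt (u p₀)).target ∈ 𝓝 (u p₀) :=
    (hf.localInverseAt (u p₀)).open_target.mem_nhds hf.self_mem_localInverseAt_target
  have h1 : ∀ᶠ p in 𝓝 p₀, u p ∈ (hf.localInverseAt (u p₀)).target := hu.preimage_mem_nhds hT
  have hcont : ContinuousAt (fun p => g₀⁻¹ • v p) p₀ :=
    (continuous_const_smul g₀⁻¹).continuousAt.comp hv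
  have h2 : ∀ᶠ p in 𝓝 p₀, g₀⁻¹ • v p ∈ (hf.localInverseAt (u p₀)).target := by
    apply hcont.preimage_mem_nhds
    have : g₀⁻¹ • v p₀ = u p₀ := by rw [← hg₀, inv_smul_smul]
    rw [this]
    exact hT
  filter_upwards [h1, h2, huv] with p hp1 hp2 hp3
  have hf_eq : f (u p) = f (g₀⁻¹ • v p) := by rw [hfG, hp3]
  have := hf.injOn_localInverseAt_target (x := u p₀) hp1 hp2 hf_eq
  rw [this, smul_inv_smul]

/-- The same statement for a surjective local homeomorphism whose fibres are EXACTLY the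
orbits (`hfib`), the form in which the quotient map `X → X/G` presents it. -/
theorem eventually_eq_smul_of_isLocalHomeomorph_of_fibres (hf : IsLocalHomeomorph f)
    (hfib : ∀ x x' : X, f x = f x' ↔ ∃ g : G, g • x = x')
    {u v : P → X} {p₀ : P} (hu : ContinuousAt u p₀) (hv : ContinuousAt v p₀)
    (huv : ∀ᶠ p in 𝓝 p₀, f (u p) = f (v p)) :
    ∃ g : G, ∀ᶠ p in 𝓝 p₀, v p = g • u p :=
  eventually_eq_smul_of_isLocalHomeomorph hf (fun g x => ((hfib (g • x) x).2 ⟨g⁻¹, inv_smul_smul g x⟩))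
    (fun x x' h => (hfib x x').1 h) hu hv huv

/-- Specialisation to the orbit-space quotient map `Quotient.mk'' : X → X ⧸ G` (Mathlib's
`MulAction.orbitRel.Quotient`): if it is a local homeomorphism, continuous families with the
same image in `X ⧸ G` near `p₀` differ near `p₀` by one fixed `g`. -/
theorem eventually_eq_smul_of_isLocalHomeomorph_orbitRel
    (hf : IsLocalHomeomorph (Quotient.mk'' : X → MulAction.orbitRel.Quotient G X))
    {u v : P → X} {p₀ : P} (hu : ContinuousAt u p₀) (hv : ContinuousAt v p₀)
    (huv : ∀ᶠ p in 𝓝 p₀,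
      (Quotient.mk'' (u p) : MulAction.orbitRel.Quotient G X) = Quotient.mk'' (v p)) :
    ∃ g : G, ∀ᶠ p in 𝓝 p₀, v p = g • u p := by
  refine eventually_eq_smul_of_isLocalHomeomorph_of_fibres hf (fun x x' => ?_) hu hv huv
  rw [Quotient.eq'', MulAction.orbitRel_apply, MulAction.mem_orbit_iff]
  constructor
  · rintro ⟨g, hg⟩
    exact ⟨g⁻¹, by rw [← hg, inv_smul_smul]⟩
  · rintro ⟨g, hg⟩
    exact ⟨g⁻¹, by rw [← hg, inv_smul_smul]⟩

end Summit.Ventures.HodgeRepro2.DeckRigidity
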